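import Literature.Computability.Cryptography.QuantumCircuit
import HarnessLib

/-!
# Stage chains of a quantum circuit family: measuring a register and feeding it to the next stage

Topic `Literature/Computability/QuantumComplexity`. The LAW-level notion consumed by iterated
(adaptive, sequential) compositions of a circuit family with itself — "run the machine, measure,
compute the next input classically from the outcome, run again" (Bernstein–Vazirani 1997, §8:
classical control inside quantum machines; Nielsen–Chuang 2010, §4.4, principle of deferred
measurement) — as used by Regev's main theorem (Regev 2009, Thm 3.1: `3n` iterations of the
iterative step, each consuming the samples produced by the previous one;
`Cryptography/RegevMainTheoremStages.lean`) and realised by the chain combinator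
`QuantumComplexity/SeqChain*.lean`:

* `stageInput x k y = ⟨x, ⟨1ᵏ, y⟩⟩` — the input handed to stage `k`: the original input, the stage
  counter in unary, and the string read off the previous stage;
* `chainLaw A F m x k` — the law of the string handed over after `k` stages of the family `F`
  (relative to the oracle `A`) on input `x`: `y₀ = []` and
  `y_{k+1} ∼ (F.kernel A (stageInput x k y_k)).map (takeD m · false)`, the measured register of a
  stage being read through a window of exactly `m` wires (its first `m` bits, zero-padded when the
  register is shorter — what the next stage's circuit copies);
* the bit tables `getD_boolPair`, `getD_stageInput` (what an assembling circuit writes wire by wire),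
  unfolding lemmas and the length invariant (`length_of_mem_support_chainLaw_succ`: after at least
  one stage the string has length `m`).

Definitions with bodies and elementary lemmas only; no named fact. (`Cryptography/RegevMainTheoremStages.lean`
landed first with private copies `UniformQCircuitFamily.stageInput` / `UniformQCircuitFamily.chainLaw`
— the special case `A = 0`, `F = S.family` of the notions here; its follow-up revision imports this
file and drops them, this being their generic home, below both consumers in the import order.)

## References

* E. Bernstein, U. Vazirani, *Quantum complexity theory*, SIAM J. Comput. 26 (1997), §8
  [BernsteinVazirani1997].
* M. A. Nielsen, I. L. Chuang, *Quantum Computation and Quantum Information*, CUP 2010, §4.4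
  (principle of deferred measurement) [NielsenChuang2010].
* O. Regev, *On lattices, learning with errors, random linear codes, and cryptography*, J. ACM 56
  (2009), Thm 3.1 (proof: the loop over `rᵢ`) [Regev2009].
-/

noncomputable section

namespace Literature.Computability.QuantumComplexity

open Cryptography Complexity

variable {G : QGateSet}

/-- **The input of stage `k` of a chain**: `⟨x, ⟨1ᵏ, y⟩⟩` — the original input `x`, the stage
counter `k` in unary, and the string `y` handed over by the previous stage (`boolPair` pairing,
Arora–Barak 2009, §0.1). [cite: BernsteinVazirani1997, §8 (classical control inside quantum machines)] -/
def stageInput (x : List Bool) (k : ℕ) (y : List Bool) : List Bool :=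
  boolPair x (boolPair (List.replicate k true) y)

/-- **The bit table of a pair** `⟨x, y⟩ = x̃ 0 1 y` (doubled bits of `x`, the separator `01`, then `y`
verbatim), read with default `0` beyond the end. [cite: AroraBarak2009, §0.1 (pairing of strings)] -/
theorem getD_boolPair (x y : List Bool) (q : ℕ) :
    (boolPair x y).getD q false =
      if q < 2 * x.length then x.getD (q / 2) false
      else if q = 2 * x.length then false
      else if q = 2 * x.length + 1 then true
      else y.getD (q - (2 * x.length + 2)) false := by
  induction x generalizing q with
  | nil =>
    have e : boolPair [] y = false :: true :: y := by simp [boolPair]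
    rw [e]
    rcases q with _ | _ | q
    · simp
    · simp
    · simp only [List.getD_cons_succ, List.length_nil, Nat.mul_zero, Nat.not_lt_zero, if_false,
        Nat.zero_add]
      rw [if_neg (by omega), if_neg (by omega)]
      rfl
  | cons b x ih =>
    -- `boolPair (b :: x) y = b :: b :: boolPair x y` (the tree's `boolPair_cons`, which belongs next to
    -- `boolPair` in `Complexity/BoolEncodings.lean`; by computation here)
    rw [show boolPair (b :: x) y = b :: b :: boolPair x y from rfl]
    rcases q with _ | _ | q
    · simp
    · rw [List.getD_cons_succ, List.getD_cons_zero, List.length_cons, if_pos (by omega)]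
      rfl
    · simp only [List.getD_cons_succ, List.length_cons]
      rw [ih q]
      have e2 : (q + 1 + 1) / 2 = q / 2 + 1 := by omega
      split_ifs <;> first
        | rfl
        | (exfalso; omega)
        | (rw [e2, List.getD_cons_succ])
        | (congr 1; omega)

/-- The length of a stage input: `2|x| + 2k + 4 + |y|`. [folklore] -/
@[simp] theorem length_stageInput (x : List Bool) (k : ℕ) (y : List Bool) :
    (stageInput x k y).length = 2 * x.length + 2 * k + 4 + y.length := by
  simp only [stageInput, length_boolPair, List.length_replicate]
  ring

/-- **The bit table of a stage input** `⟨x, ⟨1ᵏ, y⟩⟩ = x̃ 01 1^{2k} 01 y`: position `q` holds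
`x_{⌊q/2⌋}` for `q < 2|x|`, then `0`, then `2k + 1` ones, then `0 1`, then `y` (default `0` beyond).
[cite: AroraBarak2009, §0.1 (pairing of strings)] -/
theorem getD_stageInput (x : List Bool) (k : ℕ) (y : List Bool) (q : ℕ) :
    (stageInput x k y).getD q false =
      if q < 2 * x.length then x.getD (q / 2) false
      else if q = 2 * x.length then false
      else if q < 2 * x.length + 2 * k + 2 then true
      else if q = 2 * x.length + 2 * k + 2 then false
      else if q = 2 * x.length + 2 * k + 3 then true
      else y.getD (q - (2 * x.length + 2 * k + 4)) false := by
  rw [stageInput, getD_boolPair]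
  have hrep : ∀ j, (boolPair (List.replicate k true) y).getD j false =
      if j < 2 * k then true else if j = 2 * k then false else if j = 2 * k + 1 then true
      else y.getD (j - (2 * k + 2)) false := by
    intro j
    rw [getD_boolPair, List.length_replicate]
    by_cases hj : j < 2 * k
    · rw [if_pos hj, if_pos hj, List.getD_eq_getElem?_getD, List.getElem?_replicate, if_pos (by omega)]
      rfl
    · rw [if_neg hj, if_neg hj]
  rw [hrep]
  split_ifs <;> first
    | rfl
    | (exfalso; omega)
    | (congr 1; omega)

/-- **The law of the string handed over after `k` stages** of the family `F` (relative to the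
oracle `A`) on input `x`, each stage's measured register being read through a window of exactly
`m` wires (`List.takeD m · false`: the first `m` bits, zero-padded): `y₀ = []`,
`y_{k+1} ∼ (F.kernel A ⟨x, ⟨1ᵏ, y_k⟩⟩).map (takeD m · false)`.
[cite: NielsenChuang2010, §4.4 (principle of deferred measurement)] -/
def chainLaw (A : Language Bool) (F : QCircuitFamily G) (m : ℕ) (x : List Bool) : ℕ → PMF (List Bool)
  | 0 => PMF.pure []
  | k + 1 => (chainLaw A F m x k).bind fun y =>
      (F.kernel A (stageInput x k y)).map fun w => w.takeD m false

/-- No stage: the empty string. [folklore] -/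
@[simp] theorem chainLaw_zero (A : Language Bool) (F : QCircuitFamily G) (m : ℕ) (x : List Bool) :
    chainLaw A F m x 0 = PMF.pure [] :=
  rfl

/-- One more stage. [folklore] -/
theorem chainLaw_succ (A : Language Bool) (F : QCircuitFamily G) (m : ℕ) (x : List Bool) (k : ℕ) :
    chainLaw A F m x (k + 1) =
      (chainLaw A F m x k).bind fun y =>
        (F.kernel A (stageInput x k y)).map fun w => w.takeD m false :=
  rfl

/-- The first stage runs on `⟨x, ⟨1⁰, []⟩⟩`. [folklore] -/
theorem chainLaw_one (A : Language Bool) (F : QCircuitFamily G) (m : ℕ) (x : List Bool) :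
    chainLaw A F m x 1 = (F.kernel A (stageInput x 0 [])).map fun w => w.takeD m false := by
  rw [chainLaw_succ, chainLaw_zero, PMF.pure_bind]

/-- **The length invariant**: after at least one stage the handed-over string has length exactly
`m` (the window width). [folklore] -/
theorem length_of_mem_support_chainLaw_succ (A : Language Bool) (F : QCircuitFamily G) (m : ℕ)
    (x : List Bool) (k : ℕ) {y : List Bool} (hy : y ∈ (chainLaw A F m x (k + 1)).support) :
    y.length = m := by
  rw [chainLaw_succ, PMF.mem_support_bind_iff] at hy
  obtain ⟨y', -, hy⟩ := hy
  rw [PMF.mem_support_map_iff] at hy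
  obtain ⟨w, -, rfl⟩ := hy
  exact List.takeD_length _ _ _

end Literature.Computability.QuantumComplexity

end
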